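import Mathlib
import HarnessLib
import Summits.Ventures.LatticeQCDFlow.Exactness.SUNResidualTangentDerivative

/-!
# The time derivative of the tangential block of the `SU(N)` residual isotopy, and locality of the tangential operator

HONEST FRAMING: exact (Metropolis-corrected) sampling algorithms for lattice gauge theory;
figures of merit are autocorrelation/cost numbers at stated couplings and volumes; no
continuum-physics claim.

Venture `LatticeQCDFlow` (cell pub-lqcd), topic `Exactness`; FANOUT row 10 (`eng-equiv`: `equiv/residual.py`,
`flows_jax/residual_flow.py` — residual / stout / stout-defect layers and their closed-form per-link log-det).
NEW WORK of the cell; no definition (local notations only); nothing cited as a fact.  Series "the residual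
layer's exact Jacobian IS the closed form" (8 files: `SUNJacobianTraceAlgebra`, `SUNResidualTangentDerivative`,
`SUNResidualTangentTimeDerivative`, `SUNResidualGeneratorDivergence`, `SUNResidualJacobiTrace`,
`SUNResidualJacobiIdentity`, `SUNResidualJacobiFlow`, `SUNResidualLayerJacobianDet`), continuing gen-11's
`SUNResidualLayerVelocity` … `SUNResidualLayerJacobian` (existence of a continuous positive exact Jacobian).

File 3 of the series (local notations as in `SUNResidualTangentDerivative`).
* `hasDerivAt_fderiv_residualIsotopy_tau` — `d/dτ (D_W famb[τ](U) v)_a = (D Qamb_a(U) v) famb_a + Qamb_a(U) (D_W famb[τ](U) v)_a`;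
* **`hasDerivAt_residualTangentBlock_tau`** — `d/dτ Blk[τ, U, a] X = D Qamb_a(U)·single a (X U_a) + [Qamb_a(U), Blk X]`;
* `residualTangentBlock_eq_of_agree`, `residualTangentOp_eq_of_agree`, **`fderiv_residualTangentOp_apply_single_of_ne`**
  — the tangential operator of the active link `a` depends only on `U_a` and the frozen links, so its derivative
  along any other link, in tangent directions, vanishes.

Printed counterparts, NAMED ONLY: Lüscher, CMP 293 (2010) 899, §3 eqs. (3.4)–(3.9); Abbott et al.,
arXiv:2305.02402 §4.2; Morningstar–Peardon, PRD 69 (2004) 054501; Abel–Jacobi–Liouville (tree: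
`Literature.Analysis.ODE.LiouvilleFormula`).
-/

noncomputable section

namespace Summit.Ventures.LatticeQCDFlow.Exactness

open Literature.MathematicalPhysics.QuantumFieldTheory
open Literature.MathematicalPhysics.QuantumFieldTheory.Luscher2010
open Literature.MathematicalPhysics.QuantumFieldTheory.WilsonFlow
open Filter Set
open scoped Matrix Matrix.Norms.Frobenius Topology ContDiff

variable {d L n : ℕ} [NeZero L]

section TimeDerivative

variable (p : Edge d L → Prop) [DecidablePred p]
  (Q : {e : Edge d L // p e} → ({f : Edge d L // ¬p f} → Matrix.specialUnitaryGroup (Fin n) ℂ) →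
    Matrix (Fin n) (Fin n) ℂ → Matrix (Fin n) (Fin n) ℂ)
  (κ : {e : Edge d L // p e} → ({f : Edge d L // ¬p f} → Matrix.specialUnitaryGroup (Fin n) ℂ) → ℝ)
  (Qamb : {e : Edge d L // p e} → AmbConfig d L n → Matrix (Fin n) (Fin n) ℂ)

set_option quotPrecheck false in
/-- The residual isotopy at time `τ` (local notation, as in `SUNResidualIsotopy`). -/
local notation "famb[" τ "]" => (fun (W : AmbConfig d L n) (e : Edge d L) =>
  if h : p e then NormedSpace.exp ((τ : ℝ) • Qamb ⟨e, h⟩ W) * W e else W e)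

set_option quotPrecheck false in
/-- The isotopy as a map of `(τ, W)` (local notation). -/
local notation "famb₂" => (fun q : ℝ × AmbConfig d L n => (famb[q.1]) q.2)

set_option quotPrecheck false in
/-- The block of the tangential operator (local notation, as in `SUNResidualTangentOperator`). -/
local notation "Blk[" τ ", " W ", " a "]" =>
  ((fderiv ℝ (fun Y : Matrix (Fin n) (Fin n) ℂ => Y * ((famb[τ]) W a)ᴴ) 0).comp
    ((fderiv ℝ (fun W' : AmbConfig d L n => W' a) 0).comp
      ((fderiv ℝ (famb[τ]) W).comp
        ((fderiv ℝ (fun Y : Matrix (Fin n) (Fin n) ℂ => (Pi.single a Y : AmbConfig d L n)) 0).comp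
          (fderiv ℝ (fun Y : Matrix (Fin n) (Fin n) ℂ => Y * W a) 0)))))

set_option quotPrecheck false in
/-- The tangential operator (local notation, as in `SUNResidualTangentOperator`). -/
local notation "Top[" τ ", " W ", " a "]" =>
  ((fderiv ℝ (suProj (n := n)) 0).comp ((Blk[τ, W, a]).comp (fderiv ℝ (suProj (n := n)) 0)) +
    (ContinuousLinearMap.id ℝ (Matrix (Fin n) (Fin n) ℂ) - fderiv ℝ (suProj (n := n)) 0))

/-! ## The time derivative of the link derivative of the isotopy -/

/-- **Mixed derivative of the isotopy**: at an `SU(n)^E` configuration `U`, for an active link `a`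
and any ambient direction `v`,
`d/dτ (D_W famb[τ](U) v)_a = (D Qamb_a(U) v) · famb_a + Qamb_a(U) · (D_W famb[τ](U) v)_a`
(symmetry of the second derivative of the jointly `C²` map `(τ, W) ↦ famb[τ] W`, whose `τ`-derivative
is `Qamb · famb` on active links). -/
theorem hasDerivAt_fderiv_residualIsotopy_tau (hQ2 : ∀ a, ContDiff ℝ 2 (Qamb a))
    (W₀ v : AmbConfig d L n) {a : Edge d L} (ha : p a) (τ : ℝ) :
    HasDerivAt (fun τ' : ℝ => fderiv ℝ (famb[τ']) W₀ v a)
      (fderiv ℝ (Qamb ⟨a, ha⟩) W₀ v * (famb[τ]) W₀ a + Qamb ⟨a, ha⟩ W₀ * fderiv ℝ (famb[τ]) W₀ v a) τ := by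
  letI i3 : NormedAddCommGroup (AmbConfig d L n →L[ℝ] AmbConfig d L n) :=
    ContinuousLinearMap.toNormedAddCommGroup
  letI i4 : NormedSpace ℝ (AmbConfig d L n →L[ℝ] AmbConfig d L n) := ContinuousLinearMap.toNormedSpace
  letI i9 : NormedAddCommGroup (ℝ × AmbConfig d L n →L[ℝ] AmbConfig d L n) :=
    ContinuousLinearMap.toNormedAddCommGroup
  letI i10 : NormedSpace ℝ (ℝ × AmbConfig d L n →L[ℝ] AmbConfig d L n) := ContinuousLinearMap.toNormedSpace
  -- the joint map and its derivatives
  have hG2 : ContDiff ℝ 2 famb₂ := contDiff_residualIsotopy p Qamb hQ2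
  have hGd : ∀ q, HasFDerivAt famb₂ (fderiv ℝ famb₂ q) q := fun q =>
    ((hG2.differentiable (by norm_num)).differentiableAt).hasFDerivAt
  have hGc : ContDiff ℝ 1 (fderiv ℝ famb₂) := hG2.fderiv_right (by norm_num)
  have hGcd : ∀ q, HasFDerivAt (fderiv ℝ famb₂) (fderiv ℝ (fderiv ℝ famb₂) q) q := fun q =>
    ((hGc.differentiable (by norm_num)).differentiableAt).hasFDerivAt
  -- partial derivatives of `famb₂`
  have hDW : ∀ (τ' : ℝ) (W v' : AmbConfig d L n),
      fderiv ℝ (famb[τ']) W v' = fderiv ℝ famb₂ (τ', W) ((0 : ℝ), v') := by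
    intro τ' W v'
    have h1 : HasFDerivAt (famb[τ'])
        ((fderiv ℝ famb₂ (τ', W)).comp (ContinuousLinearMap.inr ℝ ℝ (AmbConfig d L n))) W :=
      (hGd (τ', W)).comp W (hasFDerivAt_prodMk_right τ' W)
    rw [h1.fderiv]
    rfl
  have hDτ : ∀ (τ' : ℝ) (W : AmbConfig d L n),
      fderiv ℝ famb₂ (τ', W) ((1 : ℝ), (0 : AmbConfig d L n)) =
        fun e => if h : p e then Qamb ⟨e, h⟩ W * (famb[τ']) W e else 0 := by
    intro τ' W
    have h1 : HasDerivAt (fun τ'' : ℝ => (famb[τ'']) W)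
        (fderiv ℝ famb₂ (τ', W) ((1 : ℝ), (0 : AmbConfig d L n))) τ' :=
      HasFDerivAt.comp_hasDerivAt (l := famb₂) (f := fun τ'' : ℝ => (τ'', W)) τ' (hGd (τ', W))
        ((hasDerivAt_id τ').prodMk (hasDerivAt_const τ' W))
    exact h1.unique (hasDerivAt_residualIsotopy_tau p Qamb W τ')
  -- (A4) τ-derivative of the `W`-partial
  have hA4 : HasDerivAt (fun τ' : ℝ => fderiv ℝ famb₂ (τ', W₀) ((0 : ℝ), v))
      ((fderiv ℝ (fderiv ℝ famb₂) (τ, W₀) ((1 : ℝ), (0 : AmbConfig d L n))) ((0 : ℝ), v)) τ := by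
    have hcurve : HasDerivAt (fun τ' : ℝ => ((τ', W₀) : ℝ × AmbConfig d L n)) ((1 : ℝ), (0 : AmbConfig d L n)) τ :=
      (hasDerivAt_id τ).prodMk (hasDerivAt_const τ W₀)
    have h1 : HasDerivAt (fun τ' : ℝ => fderiv ℝ famb₂ (τ', W₀))
        (fderiv ℝ (fderiv ℝ famb₂) (τ, W₀) ((1 : ℝ), (0 : AmbConfig d L n))) τ :=
      (hGcd (τ, W₀)).comp_hasDerivAt τ hcurve
    exact (ContinuousLinearMap.apply ℝ (AmbConfig d L n) (((0 : ℝ), v) : ℝ × AmbConfig d L n)).hasFDerivAt.comp_hasDerivAt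
      τ h1
  -- (A5) symmetry
  have hsymm : (fderiv ℝ (fderiv ℝ famb₂) (τ, W₀) ((1 : ℝ), (0 : AmbConfig d L n))) ((0 : ℝ), v) =
      (fderiv ℝ (fderiv ℝ famb₂) (τ, W₀) ((0 : ℝ), v)) ((1 : ℝ), (0 : AmbConfig d L n)) :=
    (hG2.contDiffAt.isSymmSndFDerivAt (by simp)) _ _
  -- (A6) the swapped second derivative is the `W`-derivative of the `τ`-partial
  have hΘC : ContDiff ℝ 1 (fun q : ℝ × AmbConfig d L n => fderiv ℝ famb₂ q ((1 : ℝ), (0 : AmbConfig d L n))) :=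
    hGc.clm_apply contDiff_const
  have hΘd : DifferentiableAt ℝ (fun q : ℝ × AmbConfig d L n => fderiv ℝ famb₂ q ((1 : ℝ), (0 : AmbConfig d L n)))
      (τ, W₀) := ((hΘC.differentiable (by norm_num)).differentiableAt)
  have hA6a : (fderiv ℝ (fderiv ℝ famb₂) (τ, W₀) ((0 : ℝ), v)) ((1 : ℝ), (0 : AmbConfig d L n)) =
      fderiv ℝ (fun q : ℝ × AmbConfig d L n => fderiv ℝ famb₂ q ((1 : ℝ), (0 : AmbConfig d L n))) (τ, W₀)
        ((0 : ℝ), v) := by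
    have h1 : HasFDerivAt (fun q : ℝ × AmbConfig d L n => fderiv ℝ famb₂ q ((1 : ℝ), (0 : AmbConfig d L n)))
        ((ContinuousLinearMap.apply ℝ (AmbConfig d L n) (((1 : ℝ), (0 : AmbConfig d L n)) : ℝ × AmbConfig d L n)).comp
          (fderiv ℝ (fderiv ℝ famb₂) (τ, W₀))) (τ, W₀) :=
      (ContinuousLinearMap.apply ℝ (AmbConfig d L n) (((1 : ℝ), (0 : AmbConfig d L n)) : ℝ × AmbConfig d L n)).hasFDerivAt.comp
        (τ, W₀) (hGcd (τ, W₀))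
    have h2 : fderiv ℝ (fun q : ℝ × AmbConfig d L n => fderiv ℝ famb₂ q ((1 : ℝ), (0 : AmbConfig d L n))) (τ, W₀) =
        (ContinuousLinearMap.apply ℝ (AmbConfig d L n) (((1 : ℝ), (0 : AmbConfig d L n)) : ℝ × AmbConfig d L n)).comp
          (fderiv ℝ (fderiv ℝ famb₂) (τ, W₀)) := h1.fderiv
    have h3 := congrArg (fun T : ℝ × AmbConfig d L n →L[ℝ] AmbConfig d L n => T ((0 : ℝ), v)) h2
    exact h3.symm
  -- the `W`-slice of the `τ`-partial
  have hslice : HasFDerivAt (fun W : AmbConfig d L n => fderiv ℝ famb₂ (τ, W) ((1 : ℝ), (0 : AmbConfig d L n)))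
      ((fderiv ℝ (fun q : ℝ × AmbConfig d L n => fderiv ℝ famb₂ q ((1 : ℝ), (0 : AmbConfig d L n))) (τ, W₀)).comp
        (ContinuousLinearMap.inr ℝ ℝ (AmbConfig d L n))) W₀ :=
    hΘd.hasFDerivAt.comp W₀ (hasFDerivAt_prodMk_right τ W₀)
  have hA6b : fderiv ℝ (fun q : ℝ × AmbConfig d L n => fderiv ℝ famb₂ q ((1 : ℝ), (0 : AmbConfig d L n))) (τ, W₀)
      ((0 : ℝ), v) =
      fderiv ℝ (fun W : AmbConfig d L n => fderiv ℝ famb₂ (τ, W) ((1 : ℝ), (0 : AmbConfig d L n))) W₀ v := by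
    rw [hslice.fderiv]
    rfl
  -- the `a`-component of the `τ`-partial is the product `Qamb_a · famb_a`
  have hΘa : (fun W : AmbConfig d L n => fderiv ℝ famb₂ (τ, W) ((1 : ℝ), (0 : AmbConfig d L n)) a) =
      fun W => Qamb ⟨a, ha⟩ W * (famb[τ]) W a := by
    funext W
    rw [hDτ]
    simp only [ha, ↓reduceDIte]
  have hsliceA : HasFDerivAt (fun W : AmbConfig d L n => fderiv ℝ famb₂ (τ, W) ((1 : ℝ), (0 : AmbConfig d L n)) a)
      ((ContinuousLinearMap.proj (R := ℝ) (φ := fun _ : Edge d L => Matrix (Fin n) (Fin n) ℂ) a).comp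
        ((fderiv ℝ (fun q : ℝ × AmbConfig d L n => fderiv ℝ famb₂ q ((1 : ℝ), (0 : AmbConfig d L n))) (τ, W₀)).comp
          (ContinuousLinearMap.inr ℝ ℝ (AmbConfig d L n)))) W₀ :=
    (ContinuousLinearMap.proj (R := ℝ) (φ := fun _ : Edge d L => Matrix (Fin n) (Fin n) ℂ) a).hasFDerivAt.comp W₀ hslice
  -- the product, differentiated along the line `r ↦ W₀ + r • v`
  have hline : HasDerivAt (fun r : ℝ => W₀ + r • v) v 0 := by
    have h := ((hasDerivAt_id (0 : ℝ)).smul_const v).const_add W₀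
    rw [one_smul] at h
    exact h
  have hline0 : W₀ + (0 : ℝ) • v = W₀ := by rw [zero_smul, add_zero]
  have hQd : HasDerivAt (fun r : ℝ => Qamb ⟨a, ha⟩ (W₀ + r • v)) (fderiv ℝ (Qamb ⟨a, ha⟩) W₀ v) 0 := by
    have hd : DifferentiableAt ℝ (Qamb ⟨a, ha⟩) W₀ :=
      (((hQ2 ⟨a, ha⟩).differentiable (by norm_num)).differentiableAt)
    exact hd.hasFDerivAt.comp_hasDerivAt_of_eq (0 : ℝ) hline hline0.symm
  have hFd : HasDerivAt (fun r : ℝ => (famb[τ]) (W₀ + r • v) a) (fderiv ℝ (famb[τ]) W₀ v a) 0 := by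
    have hd : DifferentiableAt ℝ (famb[τ]) W₀ :=
      ((contDiff_residualIsotopy_right p Qamb hQ2 τ).differentiable (by norm_num)).differentiableAt
    have h := hd.hasFDerivAt.comp_hasDerivAt_of_eq (0 : ℝ) hline hline0.symm
    exact (hasDerivAt_pi.1 h) a
  have hprod : HasDerivAt (fun r : ℝ => Qamb ⟨a, ha⟩ (W₀ + r • v) * (famb[τ]) (W₀ + r • v) a)
      (fderiv ℝ (Qamb ⟨a, ha⟩) W₀ v * (famb[τ]) (W₀ + (0 : ℝ) • v) a +
        Qamb ⟨a, ha⟩ (W₀ + (0 : ℝ) • v) * fderiv ℝ (famb[τ]) W₀ v a) 0 := hQd.mul hFd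
  rw [hline0] at hprod
  have hprod' : HasDerivAt (fun r : ℝ => fderiv ℝ famb₂ (τ, W₀ + r • v) ((1 : ℝ), (0 : AmbConfig d L n)) a)
      ((fderiv ℝ (fun W : AmbConfig d L n => fderiv ℝ famb₂ (τ, W) ((1 : ℝ), (0 : AmbConfig d L n))) W₀ v) a) 0 := by
    have h := hsliceA.comp_hasDerivAt_of_eq (0 : ℝ) hline hline0.symm
    have hval : ((ContinuousLinearMap.proj (R := ℝ) (φ := fun _ : Edge d L => Matrix (Fin n) (Fin n) ℂ) a).comp
        ((fderiv ℝ (fun q : ℝ × AmbConfig d L n => fderiv ℝ famb₂ q ((1 : ℝ), (0 : AmbConfig d L n))) (τ, W₀)).comp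
          (ContinuousLinearMap.inr ℝ ℝ (AmbConfig d L n)))) v =
        (fderiv ℝ (fun W : AmbConfig d L n => fderiv ℝ famb₂ (τ, W) ((1 : ℝ), (0 : AmbConfig d L n))) W₀ v) a := by
      rw [hA6b.symm]
      rfl
    exact h.congr_deriv hval
  have hfunA : (fun r : ℝ => fderiv ℝ famb₂ (τ, W₀ + r • v) ((1 : ℝ), (0 : AmbConfig d L n)) a) =
      fun r : ℝ => Qamb ⟨a, ha⟩ (W₀ + r • v) * (famb[τ]) (W₀ + r • v) a := by
    funext r
    exact congrFun hΘa (W₀ + r • v)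
  rw [hfunA] at hprod'
  have hcompA : (fderiv ℝ (fun W : AmbConfig d L n => fderiv ℝ famb₂ (τ, W) ((1 : ℝ), (0 : AmbConfig d L n))) W₀ v) a =
      fderiv ℝ (Qamb ⟨a, ha⟩) W₀ v * (famb[τ]) W₀ a + Qamb ⟨a, ha⟩ W₀ * fderiv ℝ (famb[τ]) W₀ v a :=
    hprod'.unique hprod
  -- assemble
  have hfun : (fun τ' : ℝ => fderiv ℝ (famb[τ']) W₀ v a) = fun τ' => fderiv ℝ famb₂ (τ', W₀) ((0 : ℝ), v) a := by
    funext τ'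
    rw [hDW]
  rw [hfun]
  have h := (hasDerivAt_pi.1 hA4) a
  rw [hsymm, hA6a, hA6b, hcompA] at h
  exact h

/-- **Time derivative of the block**: at an `SU(n)^E` configuration, for an active link `a` and
every matrix `X`,
`d/dτ Blk[τ, U, a] X = D Qamb_a(U)·single a (X U_a) + [Qamb_a(U), Blk[τ, U, a] X]`. -/
theorem hasDerivAt_residualTangentBlock_tau (hQ2 : ∀ a, ContDiff ℝ 2 (Qamb a))
    (hQ : ∀ a y, ∀ U ∈ Matrix.specialUnitaryGroup (Fin n) ℂ, (Q a y U)ᴴ = -Q a y U ∧ (Q a y U).trace = 0)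
    (hQambQ : ∀ a (U : GaugeConfig d L (Matrix.specialUnitaryGroup (Fin n) ℂ)),
      Qamb a (coeConfig U) = Q a (fun f => U f) (U a.1 : Matrix (Fin n) (Fin n) ℂ))
    (U : GaugeConfig d L (Matrix.specialUnitaryGroup (Fin n) ℂ)) {a : Edge d L} (ha : p a)
    (X : Matrix (Fin n) (Fin n) ℂ) (τ : ℝ) :
    HasDerivAt (fun τ' : ℝ => (Blk[τ', coeConfig U, a]) X)
      (fderiv ℝ (Qamb ⟨a, ha⟩) (coeConfig U) (Pi.single a (X * (U a : Matrix (Fin n) (Fin n) ℂ)))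
        + (Qamb ⟨a, ha⟩ (coeConfig U) * (Blk[τ, coeConfig U, a]) X
          - (Blk[τ, coeConfig U, a]) X * Qamb ⟨a, ha⟩ (coeConfig U))) τ := by
  set W₀ := coeConfig U with hW₀
  set v : AmbConfig d L n := Pi.single a (X * (U a : Matrix (Fin n) (Fin n) ℂ)) with hv
  have hUa : W₀ a = (U a : Matrix (Fin n) (Fin n) ℂ) := coeConfig_apply U a
  -- the block as a product
  have hfun : (fun τ' : ℝ => (Blk[τ', W₀, a]) X) =
      fun τ' => fderiv ℝ (famb[τ']) W₀ v a * star ((famb[τ']) W₀ a) := by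
    funext τ'
    rw [residualTangentBlock_apply, hUa, Matrix.star_eq_conjTranspose]
  -- derivative of the first factor
  have h1 := hasDerivAt_fderiv_residualIsotopy_tau p Qamb hQ2 W₀ v ha τ
  -- derivative of the second factor
  have h2 : HasDerivAt (fun τ' : ℝ => star ((famb[τ']) W₀ a))
      (star (Qamb ⟨a, ha⟩ W₀ * (famb[τ]) W₀ a)) τ := by
    have h := (hasDerivAt_pi.1 (hasDerivAt_residualIsotopy_tau p Qamb W₀ τ)) a
    simp only [ha, ↓reduceDIte] at h
    have hfa : (fun τ' : ℝ => star ((famb[τ']) W₀ a)) =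
        fun τ' => star (NormedSpace.exp (τ' • Qamb ⟨a, ha⟩ W₀) * W₀ a) := by
      funext τ'
      simp only [ha, ↓reduceDIte]
    have hfv : (famb[τ]) W₀ a = NormedSpace.exp (τ • Qamb ⟨a, ha⟩ W₀) * W₀ a := by
      simp only [ha, ↓reduceDIte]
    rw [hfa, hfv]
    exact h.star
  have hprod := h1.mul h2
  rw [hfun]
  refine hprod.congr_deriv ?_
  -- algebra at the `SU(n)^E` configuration
  set f := (famb[τ]) W₀ a with hf
  set Qa := Qamb ⟨a, ha⟩ W₀ with hQa
  have hfmem : f ∈ Matrix.specialUnitaryGroup (Fin n) ℂ := residualIsotopy_mem p Q Qamb hQ hQambQ τ U a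
  have hffH : f * fᴴ = 1 := by
    have h := Matrix.mem_unitaryGroup_iff.mp (Matrix.mem_specialUnitaryGroup_iff.mp hfmem).1
    simpa only [Matrix.star_eq_conjTranspose] using h
  have hQskew : Qaᴴ = -Qa := by
    obtain ⟨h1', -⟩ := hQ ⟨a, ha⟩ (fun f => U f) _ (U a).2
    rw [hQa, hW₀, hQambQ]
    exact h1'
  have hB : fderiv ℝ (famb[τ]) W₀ v a = (Blk[τ, W₀, a]) X * f := by
    rw [hv, hf, hW₀]
    exact (residualTangentBlock_mul_eq p Q Qamb hQ hQambQ τ U a X).symm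
  set B := (Blk[τ, W₀, a]) X with hBdef
  rw [hB, Matrix.star_eq_conjTranspose, Matrix.star_eq_conjTranspose, Matrix.conjTranspose_mul, hQskew]
  -- `(DQ·f + Qa·(B f)) fᴴ + (B f)(fᴴ (−Qa)) = DQ + Qa B − B Qa`
  have e1 : (fderiv ℝ (Qamb ⟨a, ha⟩) W₀ v * f + Qa * (B * f)) * fᴴ = fderiv ℝ (Qamb ⟨a, ha⟩) W₀ v + Qa * B := by
    rw [Matrix.add_mul, Matrix.mul_assoc, hffH, Matrix.mul_one, Matrix.mul_assoc, Matrix.mul_assoc, hffH,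
      Matrix.mul_one]
  have e2 : B * f * (fᴴ * -Qa) = -(B * Qa) := by
    rw [Matrix.mul_neg, Matrix.mul_neg, Matrix.mul_assoc B f, ← Matrix.mul_assoc f fᴴ, hffH, Matrix.one_mul]
  rw [e1, e2]
  abel

/-! ## The tangential operator of one active link does not see the other active links -/

/-- **Locality of the block on `𝔰𝔲(n)`**: for two `SU(n)^E` configurations that agree on the active
link `a` and on every frozen link, `Blk[τ, U', a] X = Blk[τ, U, a] X` for `X ∈ 𝔰𝔲(n)` — the exponent of
the active link `a` reads only `U_a` and the frozen links. -/
theorem residualTangentBlock_eq_of_agree (hQ2 : ∀ a, ContDiff ℝ 2 (Qamb a))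
    (hQambQ : ∀ a (U : GaugeConfig d L (Matrix.specialUnitaryGroup (Fin n) ℂ)),
      Qamb a (coeConfig U) = Q a (fun f => U f) (U a.1 : Matrix (Fin n) (Fin n) ℂ))
    (τ : ℝ) {U U' : GaugeConfig d L (Matrix.specialUnitaryGroup (Fin n) ℂ)} {a : Edge d L} (ha : p a)
    (hUa : U' a = U a) (hfro : ∀ f : Edge d L, ¬p f → U' f = U f)
    {X : Matrix (Fin n) (Fin n) ℂ} (hX : Xᴴ = -X) (hX0 : X.trace = 0) :
    (Blk[τ, coeConfig U', a]) X = (Blk[τ, coeConfig U, a]) X := by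
  set y : {f : Edge d L // ¬p f} → Matrix.specialUnitaryGroup (Fin n) ℂ := fun f => U f with hy
  have hy' : (fun f : {f : Edge d L // ¬p f} => U' f) = y := by
    funext f
    exact hfro f f.2
  -- along the curve `r ↦ V[a ↦ e^{rX} V_a]` the `a`-component of the isotopy is the one-link residual map
  have hcurve : ∀ (V : GaugeConfig d L (Matrix.specialUnitaryGroup (Fin n) ℂ)),
      (fun f : {f : Edge d L // ¬p f} => V f) = y → V a = U a →
      ∀ r : ℝ, (famb[τ]) (Function.update (coeConfig V) a
        (NormedSpace.exp (r • X) * (V a : Matrix (Fin n) (Fin n) ℂ))) a =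
        NormedSpace.exp (τ • Q ⟨a, ha⟩ y (NormedSpace.exp (r • X) * (U a : Matrix (Fin n) (Fin n) ℂ))) *
          (NormedSpace.exp (r • X) * (U a : Matrix (Fin n) (Fin n) ℂ)) := by
    intro V hVy hVa r
    have hγmem : NormedSpace.exp (r • X) * (V a : Matrix (Fin n) (Fin n) ℂ) ∈
        Matrix.specialUnitaryGroup (Fin n) ℂ := exp_smul_mul_mem_specialUnitaryGroup (V a).2 hX hX0 r
    have hup : Function.update (coeConfig V) a (NormedSpace.exp (r • X) * (V a : Matrix (Fin n) (Fin n) ℂ))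
        = coeConfig (Function.update V a ⟨_, hγmem⟩) := update_coeConfig_eq V a ⟨_, hγmem⟩
    rw [hup]
    simp only [ha, ↓reduceDIte, coeConfig_apply, Function.update_self]
    rw [hQambQ ⟨a, ha⟩]
    have hfro' : (fun f : {f : Edge d L // ¬p f} => Function.update V a ⟨_, hγmem⟩ f) = y := by
      rw [← hVy]
      funext f
      have hfa : (f : Edge d L) ≠ a := fun h => f.2 (h ▸ ha)
      exact Function.update_of_ne hfa _ _
    rw [hfro']
    simp only [Function.update_self, hVa]
  -- the two derivatives are derivatives of the same curve
  have hD : ∀ (V : GaugeConfig d L (Matrix.specialUnitaryGroup (Fin n) ℂ)),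
      (fun f : {f : Edge d L // ¬p f} => V f) = y → V a = U a →
      HasDerivAt (fun r : ℝ => NormedSpace.exp (τ • Q ⟨a, ha⟩ y (NormedSpace.exp (r • X) *
          (U a : Matrix (Fin n) (Fin n) ℂ))) * (NormedSpace.exp (r • X) * (U a : Matrix (Fin n) (Fin n) ℂ)))
        (fderiv ℝ (famb[τ]) (coeConfig V) (Pi.single a (X * (V a : Matrix (Fin n) (Fin n) ℂ))) a) 0 := by
    intro V hVy hVa
    have h := (hasDerivAt_pi.1 (hasDerivAt_residualIsotopy_comp_update p Qamb hQ2 τ (coeConfig V) a X)) a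
    simp only [coeConfig_apply] at h
    have hfun : (fun r : ℝ => (famb[τ]) (Function.update (coeConfig V) a
        (NormedSpace.exp (r • X) * (V a : Matrix (Fin n) (Fin n) ℂ))) a) =
        fun r => NormedSpace.exp (τ • Q ⟨a, ha⟩ y (NormedSpace.exp (r • X) * (U a : Matrix (Fin n) (Fin n) ℂ))) *
          (NormedSpace.exp (r • X) * (U a : Matrix (Fin n) (Fin n) ℂ)) := funext (hcurve V hVy hVa)
    rw [hfun] at h
    exact h
  have hderiv_eq : fderiv ℝ (famb[τ]) (coeConfig U') (Pi.single a (X * (U' a : Matrix (Fin n) (Fin n) ℂ))) a =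
      fderiv ℝ (famb[τ]) (coeConfig U) (Pi.single a (X * (U a : Matrix (Fin n) (Fin n) ℂ))) a :=
    (hD U' hy' hUa).unique (hD U rfl rfl)
  have hfa : (famb[τ]) (coeConfig U') a = (famb[τ]) (coeConfig U) a := by
    simp only [ha, ↓reduceDIte, coeConfig_apply]
    rw [hQambQ ⟨a, ha⟩, hQambQ ⟨a, ha⟩, hy', hUa]
  rw [residualTangentBlock_apply, residualTangentBlock_apply, coeConfig_apply, coeConfig_apply, hderiv_eq, hfa]

/-- **Locality of the tangential operator**: under the same agreement, `Top[τ, U', a] = Top[τ, U, a]`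
as operators (the block is only ever applied to `𝒫 v ∈ 𝔰𝔲(n)`). -/
theorem residualTangentOp_eq_of_agree (hQ2 : ∀ a, ContDiff ℝ 2 (Qamb a))
    (hQambQ : ∀ a (U : GaugeConfig d L (Matrix.specialUnitaryGroup (Fin n) ℂ)),
      Qamb a (coeConfig U) = Q a (fun f => U f) (U a.1 : Matrix (Fin n) (Fin n) ℂ))
    (τ : ℝ) {U U' : GaugeConfig d L (Matrix.specialUnitaryGroup (Fin n) ℂ)} {a : Edge d L} (ha : p a)
    (hUa : U' a = U a) (hfro : ∀ f : Edge d L, ¬p f → U' f = U f) (v : Matrix (Fin n) (Fin n) ℂ) :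
    (Top[τ, coeConfig U', a]) v = (Top[τ, coeConfig U, a]) v := by
  rw [residualTangentOp_apply, residualTangentOp_apply, ← residualTangentBlock_apply, ← residualTangentBlock_apply,
    residualTangentBlock_eq_of_agree p Q Qamb hQ2 hQambQ τ ha hUa hfro (conjTranspose_suProj v) (trace_suProj v)]

/-- **Cross-link derivatives of the tangential operator vanish.**  At an `SU(n)^E` configuration, for
an active link `a`, another link `b ≠ a` and `Y ∈ 𝔰𝔲(n)`:
`∂_{single b (Y U_b)} (Top[τ, ·, a] v) = 0` — along `r ↦ U[b ↦ e^{rY} U_b]` the operator is constant. -/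
theorem fderiv_residualTangentOp_apply_single_of_ne (hQ2 : ∀ a, ContDiff ℝ 2 (Qamb a))
    (hQambQ : ∀ a (U : GaugeConfig d L (Matrix.specialUnitaryGroup (Fin n) ℂ)),
      Qamb a (coeConfig U) = Q a (fun f => U f) (U a.1 : Matrix (Fin n) (Fin n) ℂ))
    (τ : ℝ) (U : GaugeConfig d L (Matrix.specialUnitaryGroup (Fin n) ℂ)) {a b : Edge d L} (ha : p a)
    (hb : p b) (hba : b ≠ a) {Y : Matrix (Fin n) (Fin n) ℂ} (hY : Yᴴ = -Y) (hY0 : Y.trace = 0)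
    (v : Matrix (Fin n) (Fin n) ℂ) :
    fderiv ℝ (fun W : AmbConfig d L n => (Top[τ, W, a]) v) (coeConfig U)
      (Pi.single b (Y * (U b : Matrix (Fin n) (Fin n) ℂ))) = 0 := by
  have hdiff : DifferentiableAt ℝ (fun W : AmbConfig d L n => (Top[τ, W, a]) v) (coeConfig U) :=
    ((contDiff_residualTangentOp_apply_right p Qamb hQ2 τ a v).differentiable (by norm_num)).differentiableAt
  have hγmem : ∀ r : ℝ, NormedSpace.exp (r • Y) * (U b : Matrix (Fin n) (Fin n) ℂ) ∈
      Matrix.specialUnitaryGroup (Fin n) ℂ := exp_smul_mul_mem_specialUnitaryGroup (U b).2 hY hY0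
  have hcomp := hdiff.hasFDerivAt.comp_hasDerivAt_of_eq (0 : ℝ)
    (hasDerivAt_update_exp_smul (coeConfig U) b Y)
    (by rw [zero_smul, NormedSpace.exp_zero, one_mul, Function.update_eq_self])
  simp only [coeConfig_apply] at hcomp
  -- the composite is constant
  have hconst : ∀ r : ℝ, (Top[τ, Function.update (coeConfig U) b
      (NormedSpace.exp (r • Y) * (U b : Matrix (Fin n) (Fin n) ℂ)), a]) v = (Top[τ, coeConfig U, a]) v := by
    intro r
    have hup : Function.update (coeConfig U) b (NormedSpace.exp (r • Y) * (U b : Matrix (Fin n) (Fin n) ℂ))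
        = coeConfig (Function.update U b ⟨_, hγmem r⟩) := update_coeConfig_eq U b ⟨_, hγmem r⟩
    rw [hup]
    refine residualTangentOp_eq_of_agree p Q Qamb hQ2 hQambQ τ ha ?_ (fun f hf => ?_) v
    · exact Function.update_of_ne (Ne.symm hba) _ _
    · have hfb : f ≠ b := fun h => hf (h ▸ hb)
      exact Function.update_of_ne hfb _ _
  have hconst' : HasDerivAt (fun r : ℝ => (Top[τ, Function.update (coeConfig U) b
      (NormedSpace.exp (r • Y) * (U b : Matrix (Fin n) (Fin n) ℂ)), a]) v) 0 0 := by
    have h1 : (fun r : ℝ => (Top[τ, Function.update (coeConfig U) b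
        (NormedSpace.exp (r • Y) * (U b : Matrix (Fin n) (Fin n) ℂ)), a]) v) = fun _ => (Top[τ, coeConfig U, a]) v :=
      funext hconst
    rw [h1]
    exact hasDerivAt_const 0 _
  exact hcomp.unique hconst'

end TimeDerivative

end Summit.Ventures.LatticeQCDFlow.Exactness

end
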